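import Mathlib
import Summits.CriticalPhenomena.CardyFormulaZ2.Theorems.CardyFlipRussoSquareFromVoronoiHubDefs
import Literature.Probability.Percolation.VoronoiCrossing
import Literature.Probability.Percolation.SitePaths
import Literature.Probability.LatticeModels.DelaunayGraph

/-!
# Stub `stub_faithful` (K1), line `Sketch` of crux `SquareFromVoronoiHub` — Part 8:
# black cells are convex and black; black lattice crossings give black continuum paths

Crux `Summit.CriticalPhenomena.CardyFormulaZ2.Theses.CardyFlipRusso.SquareFromVoronoiHub`
(stmt-CriticalPhenomena-6434), line `Sketch` (card `voronoi-blocks-on-fixed-gs`), stub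
`stub_faithful` (K1); registered sub-goal `stub_faithful_part8`.  The deterministic core of step
(1)(a) of the stub (lattice ⇒ continuum) and of the re-routing through cells in (1)(b), for the
colouring `blackRegion B W` of `VoronoiCrossing.lean` by closed nucleus sets `B` (black), `W`
(white) — Bollobás–Riordan, *Percolation* (2006), Ch. 8 §8.1 ("each cell takes the colour of its
nucleus"; "a black cluster is a maximal connected set of black points"):

* `convex_voronoiCell`: Voronoi cells (tree: `LatticeModels.voronoiCell`) of any set of sites in a
  real inner product space are convex (intersections of closed half-spaces);
* `voronoiCell_subset_blackRegion`: the cell of a black nucleus (w.r.t. all nuclei `B ∪ W`) is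
  black; `exists_mem_voronoiCell_of_mem_blackRegion`: a black point lies in the cell of some black
  nucleus (`B`, `W` closed and non-empty: a nearest black nucleus is a nearest nucleus);
* `joinedIn_blackRegion_of_mem_voronoiCell` / `…_of_inter_nonempty`: two points of one black
  cell, or of two INTERSECTING black cells, are joined inside the black region (segments in
  convex black cells);
* **`joinedIn_blackRegion_of_dist_le`**: hence, on the event that the cells of black nuclei
  containing two points at distance `≤ δ` intersect (no sub-mesh defect: Parts ≥ 9, first
  moments), any two black points at distance `≤ δ` are joined inside the black region;
* **`exists_joinedIn_blackRegion_of_mem_crudeCrossing`** (lattice ⇒ continuum for the crux's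
  events): on that event, a crude block crossing `blockConfig δ s c ∈ crudeCrossing R δ` yields a
  black continuum path from within `2δ` of the arc `(ab)` to within `2δ` of `(cd)` (adjacent sites
  of `δ • G_s` are at distance `≤ δ`, `dist_le_of_Gs_adj`; induction along the open path).
-/

noncomputable section

namespace Summit.CriticalPhenomena.CardyFormulaZ2.Cruxes.SquareFromVoronoiHub.VoronoiBlocks.Faithful

open scoped Pointwise Topology RealInnerProductSpace
open Set Metric Filter
open Literature.Probability.Percolation (SiteConfig siteConnIn PathIn blackRegion mem_blackRegion)
open Literature.Probability.LatticeModels (voronoiCell mem_voronoiCell_iff self_mem_voronoiCell)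
open Literature.Probability.RandomPlanarGeometry (ConformalRectangle)
open Literature.Analysis.FunctionSpaces (PointConfig)

/-! ### Voronoi cells are convex -/

section Convex

variable {F : Type*} [NormedAddCommGroup F] [InnerProductSpace ℝ F]

/-- The set of points at least as close to `p` as to `q` is the closed half-space
`{x | ⟪q - p, x⟫ ≤ (‖q‖² - ‖p‖²)/2}`, hence convex. [folklore] -/
theorem convex_setOf_dist_le (p q : F) : Convex ℝ {x : F | dist x p ≤ dist x q} := by
  have e : {x : F | dist x p ≤ dist x q} = {x : F | ⟪q - p, x⟫ ≤ (‖q‖ ^ 2 - ‖p‖ ^ 2) / 2} := by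
    ext x
    simp only [mem_setOf_eq, dist_eq_norm]
    rw [← sq_le_sq₀ (norm_nonneg _) (norm_nonneg _), norm_sub_sq_real, norm_sub_sq_real,
      inner_sub_left, real_inner_comm q x, real_inner_comm p x]
    constructor <;> intro h <;> linarith
  rw [e]
  exact convex_halfSpace_le (innerₛₗ ℝ (q - p)).isLinear _

/-- **Voronoi cells are convex** (an intersection of closed half-spaces). [folklore] -/
theorem convex_voronoiCell (ω : Set F) (p : F) : Convex ℝ (voronoiCell ω p) := by
  have e : voronoiCell ω p = ⋂ q ∈ ω, {x : F | dist x p ≤ dist x q} := by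
    ext x; simp only [mem_voronoiCell_iff, mem_iInter, mem_setOf_eq]
  rw [e]
  exact convex_iInter₂ fun q _ => convex_setOf_dist_le p q

end Convex

/-! ### Black cells are black; black points have black cells -/

variable {B W : Set ℂ}

/-- **The cell of a black nucleus is black**: if `b ∈ B` and `W ≠ ∅`, every point of the Voronoi
cell of `b` among all nuclei `B ∪ W` is at least as close to `B` as to `W`
(Bollobás–Riordan 2006, Ch. 8 §8.1: "each cell takes the colour of its nucleus").
[cite: BollobasRiordan2006, Ch. 8 §8.1] -/
theorem voronoiCell_subset_blackRegion {b : ℂ} (hb : b ∈ B) (hW : W.Nonempty) :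
    voronoiCell (B ∪ W) b ⊆ blackRegion B W := by
  intro z hz
  rw [mem_blackRegion]
  rw [mem_voronoiCell_iff] at hz
  calc infDist z B ≤ dist z b := infDist_le_dist_of_mem hb
    _ ≤ infDist z W := (le_infDist hW).2 fun q hq => hz q (Or.inr hq)

/-- **A black point lies in the cell of a black nucleus**: for closed non-empty `B`, `W`, a point
`z` with `infDist z B ≤ infDist z W` has a nearest black nucleus `b`, which is then a nearest
nucleus overall, i.e. `z ∈ voronoiCell (B ∪ W) b`. [cite: BollobasRiordan2006, Ch. 8 §8.1] -/
theorem exists_mem_voronoiCell_of_mem_blackRegion (hBc : IsClosed B) (hBne : B.Nonempty)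
    {z : ℂ} (hz : z ∈ blackRegion B W) : ∃ b ∈ B, z ∈ voronoiCell (B ∪ W) b := by
  obtain ⟨b, hb, hbd⟩ := hBc.exists_infDist_eq_dist hBne z
  refine ⟨b, hb, mem_voronoiCell_iff.2 fun q hq => ?_⟩
  rw [← hbd]
  rcases hq with hq | hq
  · exact infDist_le_dist_of_mem hq
  · exact (mem_blackRegion.1 hz).trans (infDist_le_dist_of_mem hq)

/-! ### Joining inside the black region -/

/-- Two points of the cell of a black nucleus are joined inside the black region (the cell is
convex, hence path connected, and black). [folklore] -/
theorem joinedIn_blackRegion_of_mem_voronoiCell {b : ℂ} (hb : b ∈ B) (hW : W.Nonempty) {z z' : ℂ}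
    (hz : z ∈ voronoiCell (B ∪ W) b) (hz' : z' ∈ voronoiCell (B ∪ W) b) :
    JoinedIn (blackRegion B W) z z' :=
  (((convex_voronoiCell (B ∪ W) b).isPathConnected ⟨z, hz⟩).joinedIn z hz z' hz').mono
    (voronoiCell_subset_blackRegion hb hW)

/-- Two points of two INTERSECTING cells of black nuclei are joined inside the black region
(through a common point of the two cells). [folklore] -/
theorem joinedIn_blackRegion_of_inter_nonempty {b b' : ℂ} (hb : b ∈ B) (hb' : b' ∈ B)
    (hW : W.Nonempty) {z z' : ℂ} (hz : z ∈ voronoiCell (B ∪ W) b)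
    (hz' : z' ∈ voronoiCell (B ∪ W) b')
    (hint : (voronoiCell (B ∪ W) b ∩ voronoiCell (B ∪ W) b').Nonempty) :
    JoinedIn (blackRegion B W) z z' := by
  obtain ⟨m, hm, hm'⟩ := hint
  exact (joinedIn_blackRegion_of_mem_voronoiCell hb hW hz hm).trans
    (joinedIn_blackRegion_of_mem_voronoiCell hb' hW hm' hz')

/-- **Black points at distance `≤ δ` are joined inside the black region, absent sub-mesh
defects.**  Let `B`, `W` be closed and non-empty, and assume (NO SUB-MESH DEFECT at scale `δ`)
that the cells of any two black nuclei containing points at distance `≤ δ` intersect.  Then any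
two black points at distance `≤ δ` are joined by a path inside the black region (each lies in the
cell of a black nucleus, `exists_mem_voronoiCell_of_mem_blackRegion`; the two cells meet).
[folklore] -/
theorem joinedIn_blackRegion_of_dist_le (hBc : IsClosed B) (hBne : B.Nonempty) (hW : W.Nonempty)
    {δ : ℝ}
    (hND : ∀ b ∈ B, ∀ b' ∈ B, ∀ z ∈ voronoiCell (B ∪ W) b, ∀ z' ∈ voronoiCell (B ∪ W) b',
      dist z z' ≤ δ → (voronoiCell (B ∪ W) b ∩ voronoiCell (B ∪ W) b').Nonempty)
    {z z' : ℂ} (hz : z ∈ blackRegion B W) (hz' : z' ∈ blackRegion B W) (hd : dist z z' ≤ δ) :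
    JoinedIn (blackRegion B W) z z' := by
  obtain ⟨b, hb, hzb⟩ := exists_mem_voronoiCell_of_mem_blackRegion hBc hBne hz
  obtain ⟨b', hb', hzb'⟩ := exists_mem_voronoiCell_of_mem_blackRegion hBc hBne hz'
  exact joinedIn_blackRegion_of_inter_nonempty hb hb' hW hzb hzb' (hND b hb b' hb' z hzb z' hzb' hd)

/-! ### Lattice ⇒ continuum for the crux's events -/

/-- Adjacent sites of `G_s` are at distance `≤ 1` (`ℤ²` edges have length `1`, centre–corner
edges `√2/2`). [folklore] -/
theorem dist_le_one_of_Gs_adj {u v : (ℤ × ℤ) ⊕ (ℤ × ℤ)} (h : Gs.Adj u v) :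
    dist (zGs u) (zGs v) ≤ 1 := by
  simp only [Gs, SimpleGraph.fromRel_adj, ne_eq] at h
  obtain ⟨-, h | h⟩ := h
  · rcases h.2 with ⟨-, h⟩ | ⟨-, h⟩
    · exact h.le
    · exact h.le
  · rcases h.2 with ⟨-, h⟩ | ⟨-, h⟩
    · rw [dist_comm]; exact h.le
    · rw [dist_comm]; exact h.le

/-- Adjacent sites of `δ • G_s` (`δ ≥ 0`) are at distance `≤ δ`. [folklore] -/
theorem dist_le_of_Gs_adj {δ : ℝ} (hδ : 0 ≤ δ) {u v : (ℤ × ℤ) ⊕ (ℤ × ℤ)} (h : Gs.Adj u v) :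
    dist ((δ : ℂ) * zGs u) ((δ : ℂ) * zGs v) ≤ δ := by
  rw [Complex.dist_eq, ← mul_sub, norm_mul, Complex.norm_real, Real.norm_eq_abs, abs_of_nonneg hδ,
    ← Complex.dist_eq]
  exact (mul_le_mul_of_nonneg_left (dist_le_one_of_Gs_adj h) hδ).trans (mul_one δ).le

/-- **Crude block crossing ⇒ black continuum path** (step (1)(a) of the stub, on the no-defect
event).  At mesh `δ > 0` and cell scale `s`, with non-empty black and white nucleus
configurations `c.1`, `c.2` (so that the dilated nucleus sets are closed and non-empty), assume no
sub-mesh defect at scale `δ` for the dilated nuclei.  If `blockConfig δ s c ∈ crudeCrossing R δ`,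
then the black region contains a continuum path from a point within `2δ` of the arc `(ab)` to a
point within `2δ` of `(cd)` (adjacent open sites are black points at distance `≤ δ`, hence joined
inside the black region; induction along the open `G_s`-path). [folklore] -/
theorem exists_joinedIn_blackRegion_of_mem_crudeCrossing (R : ConformalRectangle) {δ : ℝ}
    (hδ : 0 < δ) (s : ℝ) (c : PointConfig ℂ × PointConfig ℂ)
    (hBc : IsClosed ((s : ℂ) • (c.1 : Set ℂ))) (hBne : ((s : ℂ) • (c.1 : Set ℂ)).Nonempty)
    (hWne : ((s : ℂ) • (c.2 : Set ℂ)).Nonempty)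
    (hND : ∀ b ∈ (s : ℂ) • (c.1 : Set ℂ), ∀ b' ∈ (s : ℂ) • (c.1 : Set ℂ),
      ∀ z ∈ voronoiCell ((s : ℂ) • (c.1 : Set ℂ) ∪ (s : ℂ) • (c.2 : Set ℂ)) b,
      ∀ z' ∈ voronoiCell ((s : ℂ) • (c.1 : Set ℂ) ∪ (s : ℂ) • (c.2 : Set ℂ)) b',
      dist z z' ≤ δ → (voronoiCell ((s : ℂ) • (c.1 : Set ℂ) ∪ (s : ℂ) • (c.2 : Set ℂ)) b ∩
        voronoiCell ((s : ℂ) • (c.1 : Set ℂ) ∪ (s : ℂ) • (c.2 : Set ℂ)) b').Nonempty)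
    (h : blockConfig δ s c ∈ crudeCrossing R δ) :
    ∃ p q : ℂ, infDist p (R.arc 0) ≤ 2 * δ ∧ infDist q (R.arc 2) ≤ 2 * δ ∧
      JoinedIn (blackRegion ((s : ℂ) • (c.1 : Set ℂ)) ((s : ℂ) • (c.2 : Set ℂ))) p q := by
  obtain ⟨u, w, hu, hw, hconn⟩ := h
  have hpath := Literature.Probability.Percolation.PathIn.of_mem_siteConnIn hconn
  refine ⟨_, _, hu, hw, ?_⟩
  -- induction along the open path: consecutive open sites are black points at distance `≤ δ`
  obtain ⟨hu0, hrel⟩ := hpath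
  set K := blackRegion ((s : ℂ) • (c.1 : Set ℂ)) ((s : ℂ) • (c.2 : Set ℂ)) with hK
  have hblack : ∀ v ∈ {y : (ℤ × ℤ) ⊕ (ℤ × ℤ) | (δ : ℂ) * zGs y ∈ R.carrier} ∩ blockConfig δ s c,
      (δ : ℂ) * zGs v ∈ K := fun v hv => hv.2
  clear hw hconn
  induction hrel with
  | refl => exact JoinedIn.refl (hblack u hu0)
  | @tail b d hub hbd ih =>
    have hb : b ∈ {y : (ℤ × ℤ) ⊕ (ℤ × ℤ) | (δ : ℂ) * zGs y ∈ R.carrier} ∩ blockConfig δ s c :=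
      (show PathIn Gs _ u b from ⟨hu0, hub⟩).right_mem
    exact ih.trans (joinedIn_blackRegion_of_dist_le hBc hBne hWne hND (hblack b hb) (hblack d hbd.2)
      (dist_le_of_Gs_adj hδ.le hbd.1))

/-- **Registered sub-goal `stub_faithful_part8`** of `stub_faithful` (K1): absent sub-mesh
defects (cells of black nuclei containing `δ`-close points intersect), black points at distance
`≤ δ` are joined inside the black region (the statement of `joinedIn_blackRegion_of_dist_le`).
[folklore] -/
theorem stub_faithful_part8 : ∀ {B W : Set ℂ}, IsClosed B → B.Nonempty → W.Nonempty → ∀ {δ : ℝ}, (∀ b ∈ B, ∀ b' ∈ B, ∀ z ∈ Literature.Probability.LatticeModels.voronoiCell (B ∪ W) b, ∀ z' ∈ Literature.Probability.LatticeModels.voronoiCell (B ∪ W) b', dist z z' ≤ δ → (Literature.Probability.LatticeModels.voronoiCell (B ∪ W) b ∩ Literature.Probability.LatticeModels.voronoiCell (B ∪ W) b').Nonempty) → ∀ {z z' : ℂ}, z ∈ blackRegion B W → z' ∈ blackRegion B W → dist z z' ≤ δ → JoinedIn (blackRegion B W) z z' :=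
  fun hBc hBne hW _ hND _ _ hz hz' hd => joinedIn_blackRegion_of_dist_le hBc hBne hW hND hz hz' hd

end Summit.CriticalPhenomena.CardyFormulaZ2.Cruxes.SquareFromVoronoiHub.VoronoiBlocks.Faithful

end
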